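import Literature.NumberTheory.Automorphic.HilbertRepTraceComparison
import Literature.NumberTheory.Automorphic.HilbertRepSchur
import HarnessLib

/-!
# Comparison of traces, irreducible case: an irreducible constituent of `π₂` occurs in `π₁`
(Jacquet–Langlands, *Automorphic forms on `GL(2)`*, LNM 114 (1970), Lemma 16.1.1, proof:
"`π₂^{β₀}` is equivalent to one of the representations `π₁^α`"; Gelbart (1975), Lemma 10.6)

Topic `NumberTheory/Automorphic`; theorems only, continuation of `HilbertRepTraceComparison`,
which proves the core of Jacquet–Langlands' Lemma 16.1.1: under the Hilbert–Schmidt inequality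
`Σ_j ‖f₂ c_j‖² ≤ Σ_i ‖f₁ b_i‖² < ∞` on a comparison datum `B ≤ 𝓑(H₁) × 𝓑(H₂)` (a `*`-closed,
product-closed subspace stable under the pairs `(π₁ v g, π₂ v g)` of a family of groups acting
unitarily), every closed `B`-stable non-degenerate subspace `σ ≤ H₂` carries a non-zero bounded
intertwiner `σ → H₁` (`exists_subspace_intertwiner_of_hilbertSchmidt_le`). Here the printed
conclusion for an **irreducible** `σ` is derived by Schur's lemma (the tree's
`IsIrreducibleFamily.exists_eq_algebraMap_of_isSelfAdjoint`, `HilbertRepSchur`):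

* `exists_isometry_intertwiner_of_hilbertSchmidt_le` — if moreover `σ` is invariant under all the
  `π₂ v g` and topologically irreducible under them (no closed invariant subspace strictly between
  `0` and `σ`), there is an **isometry `V : σ → H₁` intertwining every `G v` and `B`**: `σ` is
  unitarily equivalent to the closed invariant subspace `V(σ)` of `π₁` — "`π₂^{β₀}` is equivalent
  to some `π₁^α`" (op. cit. p. 498). Proof: for the non-zero intertwiner `T : σ → H₁`, `T^* T`
  commutes with the (unitary) restrictions of the `π₂ v g` to `σ`, hence is a real scalar `c` by
  Schur's lemma; `c ‖x‖² = ‖T x‖²` forces `c > 0`, and `V = c^{-1/2} T` is the isometry.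

Lemma 16.1.1 (i)/(ii) themselves (an isometric intertwiner defined on all of `H₂`, resp. a
unitary equivalence) follow by the printed exhaustion (Zorn's lemma over pairs of equivalent
invariant subspaces, the hypotheses passing to orthogonal complements); they are not needed by the
Jacquet–Langlands application in the tree and are not formalised here.

## References

* H. Jacquet, R. P. Langlands, *Automorphic forms on `GL(2)`*, LNM 114 (1970), §16, Lemma 16.1.1
  and its proof, pp. 497–499 [JacquetLanglands1970].
* S. Gelbart, *Automorphic forms on adele groups* (1975), Lemma 10.6 [Gelbart1975].
* A. Deitmar, S. Echterhoff, *Principles of Harmonic Analysis*, 2nd ed. (2014), Lemma 6.1.7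
  (Schur) [DeitmarEchterhoff2014].
-/

noncomputable section

open scoped InnerProductSpace ENNReal NNReal ComplexConjugate
open Filter Topology

namespace Literature.NumberTheory.Automorphic

section Schur

variable {𝔳 : Type*} {G : 𝔳 → Type*} [∀ v, Group (G v)]
  {H₁ : Type*} [NormedAddCommGroup H₁] [InnerProductSpace ℂ H₁] [CompleteSpace H₁]
  {H₂ : Type*} [NormedAddCommGroup H₂] [InnerProductSpace ℂ H₂] [CompleteSpace H₂]

/-- **An intertwiner out of an irreducible unitary representation is a multiple of an isometry**
(Schur; Deitmar–Echterhoff (2014), Lemma 6.1.7; Dixmier, *C^*-algebras*, 2.2.2). Let `σ` be a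
complex Hilbert space with a family `𝒰` of operators which is topologically irreducible
(`IsIrreducibleFamily`) and let `T : σ → H₁` be a non-zero bounded operator such that `T^* T`
commutes with `𝒰`. Then `‖T x‖ = √c ‖x‖` for some `c > 0` and all `x`; in particular
`(√c)⁻¹ T` is an isometry. [cite: DeitmarEchterhoff2014, Lemma 6.1.7] -/
theorem exists_norm_apply_eq_sqrt_mul_of_isIrreducibleFamily {σ : Type*} [NormedAddCommGroup σ]
    [InnerProductSpace ℂ σ] [CompleteSpace σ] {𝒰 : Set (σ →L[ℂ] σ)} (h𝒰 : IsIrreducibleFamily 𝒰)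
    (T : σ →L[ℂ] H₁) (hT : T ≠ 0)
    (hcomm : ∀ S ∈ 𝒰, Commute S (ContinuousLinearMap.adjoint T ∘L T)) :
    ∃ c : ℝ, 0 < c ∧ ∀ x, ‖T x‖ = Real.sqrt c * ‖x‖ := by
  have hsa : IsSelfAdjoint (ContinuousLinearMap.adjoint T ∘L T) := by
    rw [ContinuousLinearMap.isSelfAdjoint_iff', ContinuousLinearMap.adjoint_comp,
      ContinuousLinearMap.adjoint_adjoint]
  obtain ⟨c, hc⟩ := h𝒰.exists_eq_algebraMap_of_isSelfAdjoint hsa hcomm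
  -- `c ‖x‖² = ‖T x‖²`
  have hnorm : ∀ x, ‖T x‖ ^ 2 = c * ‖x‖ ^ 2 := fun x => by
    have h1 : (ContinuousLinearMap.adjoint T ∘L T) x = (c : ℂ) • x := by
      rw [hc, Algebra.algebraMap_eq_smul_one, smul_apply, one_apply_eq_self,
        RCLike.real_smul_eq_coe_smul (K := ℂ)]
      rfl
    have h2 : (⟪T x, T x⟫_ℂ) = (c : ℂ) * ⟪x, x⟫_ℂ := by
      rw [← ContinuousLinearMap.adjoint_inner_left, ← ContinuousLinearMap.comp_apply, h1,
        inner_smul_left, Complex.conj_ofReal]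
    have h3 := congrArg Complex.re h2
    rw [Complex.re_ofReal_mul] at h3
    have e1 : (⟪T x, T x⟫_ℂ).re = ‖T x‖ ^ 2 := inner_self_eq_norm_sq (𝕜 := ℂ) (T x)
    have e2 : (⟪x, x⟫_ℂ).re = ‖x‖ ^ 2 := inner_self_eq_norm_sq (𝕜 := ℂ) x
    rw [e1, e2] at h3
    exact h3
  -- `c > 0` since `T ≠ 0`
  obtain ⟨x₀, hx₀⟩ : ∃ x, T x ≠ 0 := by
    by_contra h
    push Not at h
    exact hT (ContinuousLinearMap.ext fun x => by rw [h x, zero_apply])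
  have hc0 : 0 < c := by
    have h1 : 0 < ‖T x₀‖ ^ 2 := by positivity
    rw [hnorm x₀] at h1
    have h2 : 0 ≤ ‖x₀‖ ^ 2 := sq_nonneg _
    nlinarith
  refine ⟨c, hc0, fun x => ?_⟩
  have h : ‖T x‖ ^ 2 = (Real.sqrt c * ‖x‖) ^ 2 := by
    rw [mul_pow, Real.sq_sqrt hc0.le, hnorm x]
  exact (sq_eq_sq₀ (norm_nonneg _) (by positivity)).1 h

/-- **Jacquet–Langlands, Lemma 16.1.1, irreducible case: "`π₂^{β₀}` is equivalent to some
`π₁^α`"** (LNM 114, p. 498). Let `(G v)_{v : 𝔳}` be a family of groups with unitary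
representations `π₁ v` on `H₁`, `π₂ v` on `H₂`, and `B ≤ 𝓑(H₁) × 𝓑(H₂)` a `ℂ`-subspace closed
under products, adjoints and left multiplication by every `(π₁ v g, π₂ v g)`, with the
Hilbert–Schmidt inequality `Σ_j ‖f₂ c_j‖² ≤ Σ_i ‖f₁ b_i‖² < ∞` for all `(f₁, f₂) ∈ B`
(`tr π₂(f) π₂(f)^* ≤ tr π₁(f) π₁(f)^*`). Let `σ ≤ H₂` be a closed subspace invariant under all the
`π₂ v g` and the `f₂`, **topologically irreducible** under the `π₂ v g` (every closed subspace of
`σ` invariant under them is `0` or `σ`), and on which some `f₂` is non-zero. Then there is an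
**isometry `V : σ → H₁` intertwining every `G v` (`V π₂(g) = π₁(g) V`) and `B`
(`V f₂ = f₁ V`)**: the irreducible constituent `σ` of `π₂` is unitarily equivalent to the closed
invariant subspace `V(σ)` of `π₁` (`exists_subspace_intertwiner_of_hilbertSchmidt_le`, then
Schur's lemma for `T^* T`). [cite: JacquetLanglands1970, §16, Lemma 16.1.1 (proof)] -/
theorem exists_isometry_intertwiner_of_hilbertSchmidt_le
    (π₁ : ∀ v, ContRepresentation ℂ (G v) H₁) (π₂ : ∀ v, ContRepresentation ℂ (G v) H₂)
    (hπ₁ : ∀ v, (π₁ v).IsUnitary) (hπ₂ : ∀ v, (π₂ v).IsUnitary)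
    (B : Submodule ℂ ((H₁ →L[ℂ] H₁) × (H₂ →L[ℂ] H₂)))
    (hmul : ∀ f ∈ B, ∀ h ∈ B, f * h ∈ B) (hstar : ∀ f ∈ B, star f ∈ B)
    (hG : ∀ (v : 𝔳) (g : G v), ∀ f ∈ B,
      ((π₁ v g, π₂ v g) : (H₁ →L[ℂ] H₁) × (H₂ →L[ℂ] H₂)) * f ∈ B)
    {ι : Type*} (b : HilbertBasis ι ℂ H₁) {κ : Type*} (c : HilbertBasis κ ℂ H₂)
    (hHS : ∀ f ∈ B, ∑' j, (‖f.2 (c j)‖₊ : ℝ≥0∞) ^ 2 ≤ ∑' i, (‖f.1 (b i)‖₊ : ℝ≥0∞) ^ 2)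
    (hfin : ∀ f ∈ B, ∑' i, (‖f.1 (b i)‖₊ : ℝ≥0∞) ^ 2 < ∞)
    (σ : Submodule ℂ H₂) (hσc : IsClosed (σ : Set H₂))
    (hσG : ∀ (v : 𝔳) (g : G v), ∀ x ∈ σ, π₂ v g x ∈ σ) (hσB : ∀ f ∈ B, ∀ x ∈ σ, f.2 x ∈ σ)
    (hirr : ∀ W : Submodule ℂ H₂, IsClosed (W : Set H₂) → W ≤ σ →
      (∀ (v : 𝔳) (g : G v), ∀ x ∈ W, π₂ v g x ∈ W) → W = ⊥ ∨ W = σ)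
    (hnd : ∃ f ∈ B, ∃ x ∈ σ, f.2 x ≠ 0) :
    ∃ V : σ →L[ℂ] H₁, (∀ x, ‖V x‖ = ‖x‖) ∧
      (∀ (v : 𝔳) (g : G v) (x : σ), V ⟨π₂ v g x, hσG v g x x.2⟩ = π₁ v g (V x)) ∧
      ∀ f (hf : f ∈ B) (x : σ), V ⟨f.2 x, hσB f hf x x.2⟩ = f.1 (V x) := by
  haveI : CompleteSpace σ := hσc.completeSpace_coe
  obtain ⟨T, hT0, hTG, hTB⟩ := exists_subspace_intertwiner_of_hilbertSchmidt_le π₁ π₂ hπ₁ hπ₂ B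
    hmul hstar hG b c hHS hfin σ hσc hσG hσB hnd
  -- the restrictions of the `π₂ v g` to `σ`
  have hres : ∀ (v : 𝔳) (g : G v), ∃ A : σ →L[ℂ] σ, ∀ x : σ, (A x : H₂) = π₂ v g x :=
    fun v g => ⟨((π₂ v g) ∘L σ.subtypeL).codRestrict σ fun x => hσG v g x x.2, fun x => rfl⟩
  choose A hA using hres
  -- the adjoint of the restriction of `π₂ v g` is the restriction of `π₂ v g⁻¹`
  have hAadj : ∀ (v : 𝔳) (g : G v), ContinuousLinearMap.adjoint (A v g) = A v g⁻¹ := by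
    intro v g
    symm
    rw [ContinuousLinearMap.eq_adjoint_iff]
    intro x y
    rw [Submodule.coe_inner, Submodule.coe_inner, hA, hA, ← (hπ₂ v).adjoint_apply,
      ContinuousLinearMap.adjoint_inner_left]
  -- `T` intertwines the restrictions, and so does `T^*`
  have hTA : ∀ (v : 𝔳) (g : G v), T ∘L A v g = π₁ v g ∘L T := fun v g => by
    ext x
    rw [ContinuousLinearMap.comp_apply, ContinuousLinearMap.comp_apply, ← hTG v g x]
    congr 1
    exact Subtype.ext (hA v g x)
  have hTadjA : ∀ (v : 𝔳) (g : G v),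
      ContinuousLinearMap.adjoint T ∘L π₁ v g = A v g ∘L ContinuousLinearMap.adjoint T := by
    intro v g
    have h := congrArg ContinuousLinearMap.adjoint (hTA v g⁻¹)
    rw [ContinuousLinearMap.adjoint_comp, ContinuousLinearMap.adjoint_comp, hAadj,
      (hπ₁ v).adjoint_apply, inv_inv] at h
    exact h.symm
  -- Schur for the irreducible family of restrictions
  set 𝒰 : Set (σ →L[ℂ] σ) := {S | ∃ (v : 𝔳) (g : G v), S = A v g} with h𝒰def
  have h𝒰 : IsIrreducibleFamily 𝒰 := by
    intro W hWc hWinv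
    -- push `W ≤ σ` forward to `H₂`
    set W' : Submodule ℂ H₂ := W.map σ.subtype with hW'
    have hW'c : IsClosed (W' : Set H₂) := by
      have : (W' : Set H₂) = ((↑) : σ → H₂) '' (W : Set σ) := by
        rw [hW', Submodule.map_coe]
        rfl
      rw [this]
      exact (hσc.isClosedEmbedding_subtypeVal.isClosedMap _ hWc)
    have hW'le : W' ≤ σ := by
      rw [hW']
      exact Submodule.map_subtype_le σ W
    have hW'inv : ∀ (v : 𝔳) (g : G v), ∀ x ∈ W', π₂ v g x ∈ W' := by
      intro v g x hx
      rw [hW', Submodule.mem_map] at hx ⊢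
      obtain ⟨y, hy, rfl⟩ := hx
      refine ⟨A v g y, hWinv _ ⟨v, g, rfl⟩ y hy, ?_⟩
      rw [Submodule.subtype_apply, Submodule.subtype_apply, hA]
    rcases hirr W' hW'c hW'le hW'inv with h | h
    · left
      rw [eq_bot_iff]
      intro y hy
      have : (y : H₂) ∈ W' := by
        rw [hW', Submodule.mem_map]
        exact ⟨y, hy, rfl⟩
      rw [h, Submodule.mem_bot] at this
      rw [Submodule.mem_bot]
      exact Subtype.ext this
    · right
      rw [eq_top_iff]
      intro y _
      have : (y : H₂) ∈ W' := by
        rw [h]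
        exact y.2
      rw [hW', Submodule.mem_map] at this
      obtain ⟨z, hz, hzy⟩ := this
      rw [Submodule.subtype_apply] at hzy
      rwa [← Subtype.ext hzy]
  have hcomm : ∀ S ∈ 𝒰, Commute S (ContinuousLinearMap.adjoint T ∘L T) := by
    rintro S ⟨v, g, rfl⟩
    change A v g * (ContinuousLinearMap.adjoint T ∘L T) =
      (ContinuousLinearMap.adjoint T ∘L T) * A v g
    rw [ContinuousLinearMap.mul_def, ContinuousLinearMap.mul_def, ← ContinuousLinearMap.comp_assoc,
      ← hTadjA v g, ContinuousLinearMap.comp_assoc, ← hTA v g, ContinuousLinearMap.comp_assoc]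
  obtain ⟨c₀, hc₀, hTnorm⟩ := exists_norm_apply_eq_sqrt_mul_of_isIrreducibleFamily h𝒰 T hT0 hcomm
  -- the isometry `V = (√c₀)⁻¹ T`
  have hs0 : Real.sqrt c₀ ≠ 0 := (Real.sqrt_pos.2 hc₀).ne'
  refine ⟨((Real.sqrt c₀)⁻¹ : ℂ) • T, fun x => ?_, fun v g x => ?_, fun f hf x => ?_⟩
  · rw [smul_apply, norm_smul, norm_inv, Complex.norm_real, Real.norm_of_nonneg
      (Real.sqrt_nonneg _), hTnorm x, inv_mul_cancel_left₀ hs0]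
  · rw [smul_apply, smul_apply, hTG v g x, map_smul]
  · rw [smul_apply, smul_apply, hTB f hf x, map_smul]

end Schur

end Literature.NumberTheory.Automorphic
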